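import Mathlib
import Literature.RepresentationTheory.FiniteGroups.IrreducibleCharacters
import Summits.MatrixMultiplication.MatrixMultiplication.Theses.LevelGradedCohnUmans
import Summits.MatrixMultiplication.MatrixMultiplication.Theorems.LevelGradedCohnUmansGradedDesignFamilyWreathLink
import Summits.MatrixMultiplication.MatrixMultiplication.Theorems.LevelGradedCohnUmansGradedDesignFamilyStubShareUniversality
import Summits.MatrixMultiplication.MatrixMultiplication.Theorems.GradedPricing.Negative.LoadBearing

/-!
# Lie-cell shared-wall families imply `GradedDesignFamily` — reduction to the landed engines

Route `LevelGradedCohnUmans`, crux `GradedDesignFamily` (stmt-MatrixMultiplication-7610), line `Sketch`,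
registered stub `gradedDesignFamily_of_lieCellFamilies` (siege k15, variation "reduce to landed lemmas
of this crux, then assemble").

The stub: SHARED-WALL GRADED STPP FAMILIES IN THE LIE CELLS — a fixed filling fraction `c > 0` and,
for every ratio `R`, a prime `p`, a cell `(m, k)`, the Fourier-rank-`≤ k` test space
`F = span {g ↦ ψ(tr(M g)) : rk M ≤ k} ≤ ℂ^{GL_m(𝔽_p)}` with wall `B₂ = Σ_{χ ∈ Irr ∩ F} χ(1)²`, and
`t ≥ 1` simultaneously `F`-separated pieces `(X_i, Y_i, Z_i)`, each of volume `≥ c (B₂/t)^{3/2}`,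
with `R t χ(1)² ≤ B₂` for every visible irreducible `χ` — imply the crux
`…Theses.LevelGradedCohnUmans.GradedDesignFamily`.

Structure of this file (no new mathematics; two landed engines of the line are reused BY NAME):

* REDUCTION `sharedWallFamily_of_lieCellFamily`: a Lie-cell family at ratio `R` is a shared-wall
  family at ratio `R` in the finite host `GL_m(𝔽_p)` in the sense of the hypothesis of the landed
  `stub_shareUniversality` (p92526).  The two side conditions which the stub does not carry are
  supplied from two general lemmas:
  - `span_biInvariant_of_forall_mem`: the span of a bi-stable set of functions is bi-invariant —
    bi-translation by `(a, b)` is the linear map `LinearMap.funLeft ℂ ℂ (g ↦ a g b)`, which maps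
    `span S` into `span S` as soon as it maps `S` into `S`; the generators of `F` are bi-stable by
    `rankFourierSet_biTranslate` (`tr(M·(a g b)) = tr((b M a)·g)`, `rk(b M a) ≤ rk M`);
  - `wall_pos_of_one_mem`: `0 < Σ_{χ ∈ Irr ∩ T} χ(1)²` whenever `1 ∈ T` — every term is `≥ 0` and
    the trivial character contributes `1` (`finsum_cond_pos`); here `1 ∈ F` is the generator `M = 0`.
  (Their specialisations to `F` are the landed `rankSpan_biInvariant` / `rankSpan_wall_pos` of
  `…GradedDesignFamilySharedWallLink.lean`, which this file deliberately does not import: it is an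
  independent second assembly of the stub.)
* ASSEMBLY `gradedDesignFamily_of_lieCellFamilies`: at each `ε > 0`, `stub_shareUniversality` turns
  the shared-wall families into a graded simultaneous family beating the graded budget at exponent
  `2 + ε`, and the landed graded CKSU wreath lift `gradedWreathLinkAt` (p93436) turns that family
  into the crux's clause at `ε`.

[cite: CohnKleinbergSzegedyUmans2005, Thm. 5.5, Thm. 7.1]
-/

noncomputable section

-- every declaration name below `Summit.MatrixMultiplication.MatrixMultiplication` repeats a
-- namespace component by the tree's layout (D-0017), which `linter.dupNamespace` would flag
set_option linter.dupNamespace false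

open scoped BigOperators
open Literature.RepresentationTheory.FiniteGroups
open Summit.MatrixMultiplication.MatrixMultiplication.Theses.LevelGradedCohnUmans

namespace Summit.MatrixMultiplication.MatrixMultiplication.Theorems.GradedDesignFamily.LieCellAssemblyK15

/-! ## Bi-invariance of spans of bi-stable sets -/

/-- The span of a set `S` of functions `G → ℂ` which is stable under all bi-translations
`f ↦ (g ↦ f (a g b))` is itself stable under them: bi-translation is the linear map
`LinearMap.funLeft ℂ ℂ (g ↦ a g b)`, and `map L (span S) ≤ span S` as soon as `L '' S ⊆ S`.
[folklore] -/
theorem span_biInvariant_of_forall_mem {G : Type} [Group G] (S : Set (G → ℂ))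
    (hS : ∀ f ∈ S, ∀ a b : G, (fun g : G => f (a * g * b)) ∈ S) :
    ∀ f ∈ Submodule.span ℂ S, ∀ a b : G,
      (fun g : G => f (a * g * b)) ∈ Submodule.span ℂ S := by
  intro f hf a b
  have hle : Submodule.map (LinearMap.funLeft ℂ ℂ fun g : G => a * g * b) (Submodule.span ℂ S) ≤
      Submodule.span ℂ S := by
    rw [Submodule.map_span_le]
    intro f' hf'
    exact Submodule.subset_span (hS f' hf' a b)
  exact hle (Submodule.mem_map_of_mem hf)

/-! ## The Fourier-rank-`≤ k` test space of `GL_m(𝔽_p)` -/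

/-- Bi-translating a generator `g ↦ ψ(tr(M g))` (`rk M ≤ k`) of the Fourier-rank-`≤ k` test space
by `(a, b)` gives the generator of `b M a`, again of rank `≤ k`:
`tr(M (a g b)) = tr((b M a) g)`. [folklore] -/
theorem rankFourierSet_biTranslate (p m k : ℕ) [Fact p.Prime] :
    ∀ f ∈ {f | ∃ M : Matrix (Fin m) (Fin m) (ZMod p), M.rank ≤ k ∧
        f = fun g : Matrix.GeneralLinearGroup (Fin m) (ZMod p) =>
          (ZMod.stdAddChar (Matrix.trace (M * (g : Matrix (Fin m) (Fin m) (ZMod p)))) : ℂ)},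
      ∀ a b : Matrix.GeneralLinearGroup (Fin m) (ZMod p),
        (fun g : Matrix.GeneralLinearGroup (Fin m) (ZMod p) => f (a * g * b)) ∈
          {f | ∃ M : Matrix (Fin m) (Fin m) (ZMod p), M.rank ≤ k ∧
            f = fun g : Matrix.GeneralLinearGroup (Fin m) (ZMod p) =>
              (ZMod.stdAddChar (Matrix.trace (M * (g : Matrix (Fin m) (Fin m) (ZMod p)))) : ℂ)} := by
  rintro f ⟨M, hM, rfl⟩ a b
  refine ⟨(b : Matrix (Fin m) (Fin m) (ZMod p)) * M * (a : Matrix (Fin m) (Fin m) (ZMod p)),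
    (Matrix.rank_mul_le_left _ _).trans ((Matrix.rank_mul_le_right _ _).trans hM), ?_⟩
  funext g
  have htr : Matrix.trace (M * ((a : Matrix (Fin m) (Fin m) (ZMod p)) *
      (g : Matrix (Fin m) (Fin m) (ZMod p)) * (b : Matrix (Fin m) (Fin m) (ZMod p)))) =
      Matrix.trace ((b : Matrix (Fin m) (Fin m) (ZMod p)) * M *
        (a : Matrix (Fin m) (Fin m) (ZMod p)) * (g : Matrix (Fin m) (Fin m) (ZMod p))) :=
    calc Matrix.trace (M * ((a : Matrix (Fin m) (Fin m) (ZMod p)) *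
          (g : Matrix (Fin m) (Fin m) (ZMod p)) * (b : Matrix (Fin m) (Fin m) (ZMod p))))
        = Matrix.trace ((M * ((a : Matrix (Fin m) (Fin m) (ZMod p)) *
            (g : Matrix (Fin m) (Fin m) (ZMod p)))) * (b : Matrix (Fin m) (Fin m) (ZMod p))) := by
          simp only [Matrix.mul_assoc]
      _ = Matrix.trace ((b : Matrix (Fin m) (Fin m) (ZMod p)) * (M *
            ((a : Matrix (Fin m) (Fin m) (ZMod p)) * (g : Matrix (Fin m) (Fin m) (ZMod p))))) :=
          Matrix.trace_mul_comm _ _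
      _ = Matrix.trace ((b : Matrix (Fin m) (Fin m) (ZMod p)) * M *
            (a : Matrix (Fin m) (Fin m) (ZMod p)) * (g : Matrix (Fin m) (Fin m) (ZMod p))) := by
          simp only [Matrix.mul_assoc]
  simp only [Units.val_mul, htr]

/-! ## Positivity of the wall -/

/-- If a set `T` of functions on a finite group contains the constant `1` (the trivial character),
then the wall `Σ_{χ ∈ Irr G ∩ T} χ(1)²` is positive: every term is `≥ 0` (degrees are natural
numbers) and the term of `χ = 1` equals `1`. [folklore] -/
theorem wall_pos_of_one_mem {G : Type} [Group G] [Finite G] {T : Set (G → ℂ)}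
    (h1 : (1 : G → ℂ) ∈ T) :
    0 < ∑ᶠ χ ∈ irrChars G ∩ T, (χ 1).re ^ (2 : ℝ) := by
  refine finsum_cond_pos (fun χ hχ => ?_)
    ⟨1, ⟨GradedPricing.Negative.one_mem_irrChars, h1⟩, ?_⟩ ?_
  · obtain ⟨d, -, hd⟩ := IsIrrChar.exists_apply_one hχ.1
    rw [hd, Complex.natCast_re]
    exact Real.rpow_nonneg (Nat.cast_nonneg d) _
  · simp
  · exact ((irrChars_finite_holds G).subset Set.inter_subset_left).inter_of_right _

/-! ## Reduction: a Lie-cell family is a shared-wall family in a finite host -/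

/-- **Reduction.**  A Lie-cell family at filling fraction `c` and ratio `R` (the body of the stub's
hypothesis at one `R`) is a shared-wall family at `(c, R)` in the finite host `GL_m(𝔽_p)` in the
sense of the hypothesis of the landed `stub_shareUniversality`: the test space is the span `F`
itself, bi-invariant by `span_biInvariant_of_forall_mem` + `rankFourierSet_biTranslate`, with
positive wall by `wall_pos_of_one_mem` (the trivial character is the generator `M = 0`);
separation, `1 ≤ t`, the volume floor and the degree cap are carried over verbatim.
[cite: CohnKleinbergSzegedyUmans2005, Thm. 7.1] -/
theorem sharedWallFamily_of_lieCellFamily (c R : ℝ)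
    (h : ∃ (p : ℕ) (_ : Fact p.Prime) (m k : ℕ)
      (F : Submodule ℂ (Matrix.GeneralLinearGroup (Fin m) (ZMod p) → ℂ)) (B₂ : ℝ) (t : ℕ)
      (X Y Z : Fin t → Finset (Matrix.GeneralLinearGroup (Fin m) (ZMod p))),
      F = Submodule.span ℂ {f | ∃ M : Matrix (Fin m) (Fin m) (ZMod p), M.rank ≤ k ∧
        f = fun g : Matrix.GeneralLinearGroup (Fin m) (ZMod p) =>
          (ZMod.stdAddChar (Matrix.trace (M * (g : Matrix (Fin m) (Fin m) (ZMod p)))) : ℂ)} ∧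
      B₂ = (∑ᶠ χ ∈ Literature.RepresentationTheory.FiniteGroups.irrChars
          (Matrix.GeneralLinearGroup (Fin m) (ZMod p)) ∩
        (F : Set (Matrix.GeneralLinearGroup (Fin m) (ZMod p) → ℂ)), (χ 1).re ^ (2 : ℝ)) ∧
      (∀ i : Fin t, ∀ x₀ ∈ X i, ∀ z₀ ∈ Z i, ∃ f ∈ F, ∀ j k : Fin t,
        ∀ x ∈ X j, ∀ y ∈ Y j, ∀ y' ∈ Y k, ∀ z ∈ Z k,
          ((j = i ∧ k = i ∧ x = x₀ ∧ y = y' ∧ z = z₀) → f (x⁻¹ * y * y'⁻¹ * z) = 1) ∧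
          (¬ (j = i ∧ k = i ∧ x = x₀ ∧ y = y' ∧ z = z₀) → f (x⁻¹ * y * y'⁻¹ * z) = 0)) ∧
      1 ≤ t ∧
      (∀ i, c * (B₂ / t) ^ (3 / 2 : ℝ) ≤ ((((X i).card * (Y i).card * (Z i).card : ℕ) : ℝ))) ∧
      (∀ χ ∈ Literature.RepresentationTheory.FiniteGroups.irrChars
          (Matrix.GeneralLinearGroup (Fin m) (ZMod p)) ∩
          (F : Set (Matrix.GeneralLinearGroup (Fin m) (ZMod p) → ℂ)),
        R * t * (χ 1).re ^ 2 ≤ B₂)) :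
    ∃ (G : Type) (_ : Group G) (_ : Fintype G) (J : Submodule ℂ (G → ℂ))
      (B₂ : ℝ) (t : ℕ) (X Y Z : Fin t → Finset G),
      B₂ = (∑ᶠ χ ∈ Literature.RepresentationTheory.FiniteGroups.irrChars G ∩ (J : Set (G → ℂ)),
        (χ 1).re ^ (2 : ℝ)) ∧
      (∀ f ∈ J, ∀ a b : G, (fun g : G => f (a * g * b)) ∈ J) ∧
      (∀ i : Fin t, ∀ x₀ ∈ X i, ∀ z₀ ∈ Z i, ∃ f ∈ J, ∀ j k : Fin t,
        ∀ x ∈ X j, ∀ y ∈ Y j, ∀ y' ∈ Y k, ∀ z ∈ Z k,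
          ((j = i ∧ k = i ∧ x = x₀ ∧ y = y' ∧ z = z₀) → f (x⁻¹ * y * y'⁻¹ * z) = 1) ∧
          (¬ (j = i ∧ k = i ∧ x = x₀ ∧ y = y' ∧ z = z₀) → f (x⁻¹ * y * y'⁻¹ * z) = 0)) ∧
      1 ≤ t ∧ 0 < B₂ ∧
      (∀ i, c * (B₂ / t) ^ (3 / 2 : ℝ) ≤ ((((X i).card * (Y i).card * (Z i).card : ℕ) : ℝ))) ∧
      (∀ χ ∈ Literature.RepresentationTheory.FiniteGroups.irrChars G ∩ (J : Set (G → ℂ)),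
        R * t * (χ 1).re ^ 2 ≤ B₂) := by
  obtain ⟨p, hp, m, k, F, B₂, t, X, Y, Z, hF, hB, hsep, ht, hvol, hdeg⟩ := h
  -- bi-invariance of `F`: the generators are bi-stable, hence so is their span
  have hJ : ∀ f ∈ F, ∀ a b : Matrix.GeneralLinearGroup (Fin m) (ZMod p),
      (fun g : Matrix.GeneralLinearGroup (Fin m) (ZMod p) => f (a * g * b)) ∈ F := by
    rw [hF]
    exact span_biInvariant_of_forall_mem _ (rankFourierSet_biTranslate p m k)
  -- the trivial character is the generator `M = 0` of `F`, so the wall `B₂` is positive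
  have h1 : (1 : Matrix.GeneralLinearGroup (Fin m) (ZMod p) → ℂ) ∈
      (F : Set (Matrix.GeneralLinearGroup (Fin m) (ZMod p) → ℂ)) := by
    rw [hF]
    exact Submodule.subset_span ⟨0, by simp, by funext g; simp⟩
  have hB0 : 0 < B₂ := by
    rw [hB]
    exact wall_pos_of_one_mem h1
  exact ⟨Matrix.GeneralLinearGroup (Fin m) (ZMod p), inferInstance, inferInstance, F, B₂, t, X, Y, Z,
    hB, hJ, hsep, ht, hB0, hvol, hdeg⟩

/-! ## Assembly -/

/-- **Lie-cell shared-wall families imply the crux** (the registered stub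
`gradedDesignFamily_of_lieCellFamilies` of the line `Sketch`, by name and signature).
Assembly from the landed lemmas of this crux: at each `ε > 0`, the host-free accounting
`stub_shareUniversality` (fed, ratio by ratio, through the reduction
`sharedWallFamily_of_lieCellFamily`) yields a graded simultaneous family beating the graded budget
at exponent `2 + ε`, and the graded CKSU wreath lift `gradedWreathLinkAt` turns it into a single
graded design, i.e. the crux's clause at `ε`. [cite: CohnKleinbergSzegedyUmans2005, Thm. 5.5, Thm. 7.1] -/
theorem gradedDesignFamily_of_lieCellFamilies
    (hlie : ∃ c : ℝ, 0 < c ∧ ∀ R : ℝ, ∃ (p : ℕ) (_ : Fact p.Prime) (m k : ℕ)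
      (F : Submodule ℂ (Matrix.GeneralLinearGroup (Fin m) (ZMod p) → ℂ)) (B₂ : ℝ) (t : ℕ)
      (X Y Z : Fin t → Finset (Matrix.GeneralLinearGroup (Fin m) (ZMod p))),
      F = Submodule.span ℂ {f | ∃ M : Matrix (Fin m) (Fin m) (ZMod p), M.rank ≤ k ∧
        f = fun g : Matrix.GeneralLinearGroup (Fin m) (ZMod p) =>
          (ZMod.stdAddChar (Matrix.trace (M * (g : Matrix (Fin m) (Fin m) (ZMod p)))) : ℂ)} ∧
      B₂ = (∑ᶠ χ ∈ Literature.RepresentationTheory.FiniteGroups.irrChars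
          (Matrix.GeneralLinearGroup (Fin m) (ZMod p)) ∩
        (F : Set (Matrix.GeneralLinearGroup (Fin m) (ZMod p) → ℂ)), (χ 1).re ^ (2 : ℝ)) ∧
      (∀ i : Fin t, ∀ x₀ ∈ X i, ∀ z₀ ∈ Z i, ∃ f ∈ F, ∀ j k : Fin t,
        ∀ x ∈ X j, ∀ y ∈ Y j, ∀ y' ∈ Y k, ∀ z ∈ Z k,
          ((j = i ∧ k = i ∧ x = x₀ ∧ y = y' ∧ z = z₀) → f (x⁻¹ * y * y'⁻¹ * z) = 1) ∧
          (¬ (j = i ∧ k = i ∧ x = x₀ ∧ y = y' ∧ z = z₀) → f (x⁻¹ * y * y'⁻¹ * z) = 0)) ∧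
      1 ≤ t ∧
      (∀ i, c * (B₂ / t) ^ (3 / 2 : ℝ) ≤ ((((X i).card * (Y i).card * (Z i).card : ℕ) : ℝ))) ∧
      (∀ χ ∈ Literature.RepresentationTheory.FiniteGroups.irrChars
          (Matrix.GeneralLinearGroup (Fin m) (ZMod p)) ∩
          (F : Set (Matrix.GeneralLinearGroup (Fin m) (ZMod p) → ℂ)),
        R * t * (χ 1).re ^ 2 ≤ B₂)) :
    GradedDesignFamily := by
  obtain ⟨c, hc, hall⟩ := hlie
  intro ε hε
  exact gradedWreathLinkAt ε hε.le
    (stub_shareUniversality c hc (fun R => sharedWallFamily_of_lieCellFamily c R (hall R)) ε hε)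

end Summit.MatrixMultiplication.MatrixMultiplication.Theorems.GradedDesignFamily.LieCellAssemblyK15

end
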